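import Mathlib
import Summits.AnomalousDissipation.AnomalousDissipation.Theses.DyadicWallCascade
import HarnessLib.Audit
import Summits.AnomalousDissipation.AnomalousDissipation.Theorems.DyadicWallCascadeHalfSpaceHierarchySlabExtension
import Summits.AnomalousDissipation.AnomalousDissipation.Theorems.DyadicWallCascadeHalfSpaceHierarchyCurlOfDegreeZeroField
import Summits.AnomalousDissipation.AnomalousDissipation.Theorems.DyadicWallCascadeHalfSpaceHierarchyFluxQuadruplesPerOctave
import Summits.AnomalousDissipation.AnomalousDissipation.Theorems.DyadicWallCascadeHalfSpaceHierarchySuperCriticalMatching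
import Summits.AnomalousDissipation.AnomalousDissipation.Theorems.DyadicWallCascadeHalfSpaceHierarchySubCriticalMatching
import Summits.AnomalousDissipation.AnomalousDissipation.Theorems.DyadicWallCascadeHalfSpaceHierarchyLambVector
import Summits.AnomalousDissipation.AnomalousDissipation.Theorems.DyadicWallCascadeHalfSpaceHierarchyStagnationCurve
import Summits.AnomalousDissipation.AnomalousDissipation.Theorems.DyadicWallCascadeHalfSpaceHierarchyEnergyFluxPerOctave
import Summits.AnomalousDissipation.AnomalousDissipation.Theorems.DyadicWallCascadeHalfSpaceHierarchyColumnarSwirl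
import Summits.AnomalousDissipation.AnomalousDissipation.Theorems.DyadicWallCascadeHalfSpaceHierarchyClebsch
import Summits.AnomalousDissipation.AnomalousDissipation.Theorems.DyadicWallCascadeHalfSpaceHierarchyCommutingFrame
import Summits.AnomalousDissipation.AnomalousDissipation.Theorems.DyadicWallCascadeHalfSpaceHierarchyBandTools
import Summits.AnomalousDissipation.AnomalousDissipation.Theorems.DyadicWallCascadeHalfSpaceHierarchySlabOfBand
import Literature.Analysis.FluidPDE.VectorCalculus
import Summits.AnomalousDissipation.AnomalousDissipation.Theorems.DyadicWallCascadeHalfSpaceHierarchyXIndepStreamFunction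
import Summits.AnomalousDissipation.AnomalousDissipation.Theorems.DyadicWallCascadeHalfSpaceHierarchyHeadFluxTransport
import Summits.AnomalousDissipation.AnomalousDissipation.Theorems.DyadicWallCascadeHalfSpaceHierarchyOscillatoryIBP
import Summits.AnomalousDissipation.AnomalousDissipation.Theorems.DyadicWallCascadeHalfSpaceHierarchySliceIntegral
import Summits.AnomalousDissipation.AnomalousDissipation.Theorems.DyadicWallCascadeHalfSpaceHierarchyXIndepSliceTools

/-!
# Line `Sketch` (ideator-3 sketch of the cards `octave-transfer-rpf` / `flat-bernoulli-leaves`, reshaped by the lead)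
# — skeleton for the crux `DyadicWallCascade.HalfSpaceHierarchy` (item stmt-AnomalousDissipation-18627)

The payload line `Sketch` is the ideator's `SketchIdeator3.lean` (seven `Prop` declarations, no composition).  The
lead reshapes it into the TRANSFER of its own card (`Ideas/octave-transfer-rpf.md`, §Transfer: "C⁺ ⇒ HalfSpaceHierarchy
(extend by δ-equivariance = census D1 `SlabExtension`, support-grade)") typed in the tree's vocabulary:

* `stub_slabProfile` — the band/slab profile: the crux's clauses on the OPEN slab `1/2 < z < 4` only, the dilation
  relation asked for `1/2 < z < 2` (verbatim the strategist's `StrategyCensus.SlabHierarchy`).  This is the card's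
  C⁺ stripped of its un-typed normal-form clauses; it carries ALL the new mathematics (crux-sized: the census proves
  `HalfSpaceHierarchy → SlabHierarchy`).
* `stub_slabExtension` — equivariant dyadic extension `V(X) := V(2^{-k} X)` on `2^k ≤ z < 2^{k+1}`: slab profile ⇒
  crux (census D1 `SlabExtension`; smoothness across the dyadic planes from smoothness INSIDE the slab).  Lead's stub.
* tool stubs = the card's first lemmas (`SketchIdeator3.lean`, unfolded): `stub_curlOfDegreeZeroField` (vorticity of
  a degree-0 field has degree −1), `stub_fluxQuadruplesPerOctave` (vertical flux through the dilated square is 4×),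
  `stub_lambVectorIsBernoulliGradient` (`V × curl V = ∇(‖V‖²/2 + Q)` for steady Euler),
  `stub_superCriticalMatchingInvertible` / `stub_subCriticalMatchingNotSurjective` (the abstract matching dichotomy
  `A − w•K`, `K` an isometry).  They are what `stub_slabProfile`'s construction leans on (card §First lemma); they
  do not enter the composition.

Composition: `HalfSpaceHierarchy_of := stub_slabExtension stub_slabProfile`.

STATUS (continuation lead c1, cycle 1, 2026-08-17): every stub but the residual `stub_bandProfile` is LANDED (13 `--supports`
files of the opening lead + 6 of this lead: the 2½-D no-go `not_xIndependentHalfSpaceHierarchy`, §5); the only `sorry` below is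
`stub_bandProfile` (open construction ≡ crux).

Reshape v4 (lead, cycle 1): residual weakened to the BAND profile (`stub_bandProfile`; Euler only on the open band,
no bound clause) with the lead's upgrade `stub_slabOfBand` + tools `stub_bandEulerTools`; `stub_slabProfile` expired.

Reshape v2 (lead, cycle 1): the two slab stubs are stated with the census `let S/e/pt := …` binders INLINED (the
gate's stub registry cuts a signature at its first `:=`, so a `let` inside a registered signature can never be matched);
the proposition is unchanged up to ζβ-reduction.  Landed tool stubs are listed in §3 and no longer stated.
-/

set_option linter.dupNamespace false

noncomputable section

open scoped BigOperators Topology InnerProductSpace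
open MeasureTheory
open Summit.AnomalousDissipation.AnomalousDissipation.Theses.DyadicWallCascade

namespace Summit.AnomalousDissipation.AnomalousDissipation.Cruxes.HalfSpaceHierarchy.SketchLine

/-! ## §1 The profile stub (new mathematics, crux-sized) — reshape v4: the BAND profile

v1–v3 residual `stub_slabProfile` (= census `SlabHierarchy`, lets inlined) is SUPERSEDED (expired on the item) by the
weaker-hypothesis `stub_bandProfile`: steady Euler and zero divergence are asked on the OPEN BAND `1 < z < 2` only and
there is NO bound clause — `stub_slabOfBand` (lead, §2) upgrades it to the slab profile.  Still ≡ crux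
(`bandProfile_of_halfSpaceHierarchy`, §4), still the whole construction. -/

/-- **Stub (profile, the residual).** A band profile: `(V, Q, F)` with `V, Q` smooth on the open slab `1/2 < z < 4`,
divergence free and steady Euler on the open band `1 < z < 2`, `V (2X) = V X`, `Q (2X) = Q X` for `1/2 < z < 2`
(this encodes the smooth matching across `z = 1, 2`), `1`-periodic in `x, y` on `1 ≤ z ≤ 2`, zero mass flux and energy
flux `F ≠ 0` through the unit square of `{z = 1}`.  OPEN — it is the crux's construction. -/
theorem stub_bandProfile :
    ∃ (V : EuclideanSpace ℝ (Fin 3) → EuclideanSpace ℝ (Fin 3)) (Q : EuclideanSpace ℝ (Fin 3) → ℝ) (F : ℝ),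
      ContDiffOn ℝ ((⊤ : ℕ∞) : WithTop ℕ∞) V {Y : EuclideanSpace ℝ (Fin 3) | 1 / 2 < Y 2 ∧ Y 2 < 4} ∧
      ContDiffOn ℝ ((⊤ : ℕ∞) : WithTop ℕ∞) Q {Y : EuclideanSpace ℝ (Fin 3) | 1 / 2 < Y 2 ∧ Y 2 < 4} ∧
      (∀ X : EuclideanSpace ℝ (Fin 3), 1 < X 2 → X 2 < 2 →
        ∑ i : Fin 3, (fderiv ℝ V X (EuclideanSpace.single i (1 : ℝ))) i = 0) ∧
      (∀ X : EuclideanSpace ℝ (Fin 3), 1 < X 2 → X 2 < 2 → (fderiv ℝ V X) (V X) + gradient Q X = 0) ∧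
      (∀ X : EuclideanSpace ℝ (Fin 3), 1 / 2 < X 2 → X 2 < 2 → V ((2 : ℝ) • X) = V X ∧ Q ((2 : ℝ) • X) = Q X) ∧
      (∀ X : EuclideanSpace ℝ (Fin 3), 1 ≤ X 2 → X 2 ≤ 2 →
        V (X + EuclideanSpace.single 0 (1 : ℝ)) = V X ∧ V (X + EuclideanSpace.single 1 (1 : ℝ)) = V X ∧
        Q (X + EuclideanSpace.single 0 (1 : ℝ)) = Q X ∧ Q (X + EuclideanSpace.single 1 (1 : ℝ)) = Q X) ∧
      (∫ q in Set.Icc (0 : ℝ) 1 ×ˢ Set.Icc (0 : ℝ) 1, (V !₂[q.1, q.2, (1 : ℝ)]) 2 = 0) ∧ F ≠ 0 ∧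
      (∫ q in Set.Icc (0 : ℝ) 1 ×ˢ Set.Icc (0 : ℝ) 1,
        (V !₂[q.1, q.2, (1 : ℝ)]) 2 * (‖V !₂[q.1, q.2, (1 : ℝ)]‖ ^ 2 / 2 + Q !₂[q.1, q.2, (1 : ℝ)]) = F) := by
  sorry

/-! ## §2 The transfer stub (lead): equivariant dyadic extension -/

/-- **Stub (transfer) — LANDED, p146691.** A slab hierarchy extends to a half-space hierarchy: put `Ṽ X := V (2^{-k} X)`,
`Q̃ X := Q (2^{-k} X)` for `2^k ≤ z < 2^{k+1}` (`k ∈ ℤ`); on the open sub-slab `2^{k-1} < z < 2^{k+2}` this agrees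
with `V ∘ (2^{-k} •)`, so smoothness, divergence, the Euler equation (both sides scale by `2^{-k}`) and the bounds
transfer; `Ṽ = V` on the slab gives the periodicity and flux clauses, and `Ṽ (2X) = Ṽ X` holds by construction. -/
theorem stub_slabExtension :
    (∃ (V : EuclideanSpace ℝ (Fin 3) → EuclideanSpace ℝ (Fin 3)) (Q : EuclideanSpace ℝ (Fin 3) → ℝ) (C F : ℝ),
      ContDiffOn ℝ ((⊤ : ℕ∞) : WithTop ℕ∞) V {Y : EuclideanSpace ℝ (Fin 3) | 1 / 2 < Y 2 ∧ Y 2 < 4} ∧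
      ContDiffOn ℝ ((⊤ : ℕ∞) : WithTop ℕ∞) Q {Y : EuclideanSpace ℝ (Fin 3) | 1 / 2 < Y 2 ∧ Y 2 < 4} ∧
      (∀ X ∈ {Y : EuclideanSpace ℝ (Fin 3) | 1 / 2 < Y 2 ∧ Y 2 < 4}, ‖V X‖ ≤ C ∧ |Q X| ≤ C) ∧
      (∀ X ∈ {Y : EuclideanSpace ℝ (Fin 3) | 1 / 2 < Y 2 ∧ Y 2 < 4},
        ∑ i : Fin 3, (fderiv ℝ V X (EuclideanSpace.single i (1 : ℝ))) i = 0) ∧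
      (∀ X ∈ {Y : EuclideanSpace ℝ (Fin 3) | 1 / 2 < Y 2 ∧ Y 2 < 4}, (fderiv ℝ V X) (V X) + gradient Q X = 0) ∧
      (∀ X : EuclideanSpace ℝ (Fin 3), 1 / 2 < X 2 → X 2 < 2 → V ((2 : ℝ) • X) = V X ∧ Q ((2 : ℝ) • X) = Q X) ∧
      (∀ X : EuclideanSpace ℝ (Fin 3), 1 ≤ X 2 → X 2 ≤ 2 →
        V (X + EuclideanSpace.single 0 (1 : ℝ)) = V X ∧ V (X + EuclideanSpace.single 1 (1 : ℝ)) = V X ∧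
        Q (X + EuclideanSpace.single 0 (1 : ℝ)) = Q X ∧ Q (X + EuclideanSpace.single 1 (1 : ℝ)) = Q X) ∧
      (∫ q in Set.Icc (0 : ℝ) 1 ×ˢ Set.Icc (0 : ℝ) 1, (V !₂[q.1, q.2, (1 : ℝ)]) 2 = 0) ∧ F ≠ 0 ∧
      (∫ q in Set.Icc (0 : ℝ) 1 ×ˢ Set.Icc (0 : ℝ) 1,
        (V !₂[q.1, q.2, (1 : ℝ)]) 2 * (‖V !₂[q.1, q.2, (1 : ℝ)]‖ ^ 2 / 2 + Q !₂[q.1, q.2, (1 : ℝ)]) = F)) →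
    HalfSpaceHierarchy :=
  -- LANDED p146691 (`Theorems/DyadicWallCascadeHalfSpaceHierarchySlabExtension.lean`), cited by name.
  Summit.AnomalousDissipation.AnomalousDissipation.Theorems.HalfSpaceHierarchy.stub_slabExtension

/-- **Stub (transfer, lead) `stub_slabOfBand`.** A band profile is a slab profile: Euler / divergence extend from
the open band to the slab by scale covariance off the band and continuity on the planes (`stub_bandEulerTools`), and
the bound comes for free from continuity + periodicity + the dilation relation (compact fundamental box).
LANDED p149183: `Theorems/DyadicWallCascadeHalfSpaceHierarchySlabOfBand.lean` (cited by name). -/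
theorem stub_slabOfBand :
    (∃ (V : EuclideanSpace ℝ (Fin 3) → EuclideanSpace ℝ (Fin 3)) (Q : EuclideanSpace ℝ (Fin 3) → ℝ) (F : ℝ),
      ContDiffOn ℝ ((⊤ : ℕ∞) : WithTop ℕ∞) V {Y : EuclideanSpace ℝ (Fin 3) | 1 / 2 < Y 2 ∧ Y 2 < 4} ∧
      ContDiffOn ℝ ((⊤ : ℕ∞) : WithTop ℕ∞) Q {Y : EuclideanSpace ℝ (Fin 3) | 1 / 2 < Y 2 ∧ Y 2 < 4} ∧
      (∀ X : EuclideanSpace ℝ (Fin 3), 1 < X 2 → X 2 < 2 →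
        ∑ i : Fin 3, (fderiv ℝ V X (EuclideanSpace.single i (1 : ℝ))) i = 0) ∧
      (∀ X : EuclideanSpace ℝ (Fin 3), 1 < X 2 → X 2 < 2 → (fderiv ℝ V X) (V X) + gradient Q X = 0) ∧
      (∀ X : EuclideanSpace ℝ (Fin 3), 1 / 2 < X 2 → X 2 < 2 → V ((2 : ℝ) • X) = V X ∧ Q ((2 : ℝ) • X) = Q X) ∧
      (∀ X : EuclideanSpace ℝ (Fin 3), 1 ≤ X 2 → X 2 ≤ 2 →
        V (X + EuclideanSpace.single 0 (1 : ℝ)) = V X ∧ V (X + EuclideanSpace.single 1 (1 : ℝ)) = V X ∧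
        Q (X + EuclideanSpace.single 0 (1 : ℝ)) = Q X ∧ Q (X + EuclideanSpace.single 1 (1 : ℝ)) = Q X) ∧
      (∫ q in Set.Icc (0 : ℝ) 1 ×ˢ Set.Icc (0 : ℝ) 1, (V !₂[q.1, q.2, (1 : ℝ)]) 2 = 0) ∧ F ≠ 0 ∧
      (∫ q in Set.Icc (0 : ℝ) 1 ×ˢ Set.Icc (0 : ℝ) 1,
        (V !₂[q.1, q.2, (1 : ℝ)]) 2 * (‖V !₂[q.1, q.2, (1 : ℝ)]‖ ^ 2 / 2 + Q !₂[q.1, q.2, (1 : ℝ)]) = F)) →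
    ∃ (V : EuclideanSpace ℝ (Fin 3) → EuclideanSpace ℝ (Fin 3)) (Q : EuclideanSpace ℝ (Fin 3) → ℝ) (C F : ℝ),
      ContDiffOn ℝ ((⊤ : ℕ∞) : WithTop ℕ∞) V {Y : EuclideanSpace ℝ (Fin 3) | 1 / 2 < Y 2 ∧ Y 2 < 4} ∧
      ContDiffOn ℝ ((⊤ : ℕ∞) : WithTop ℕ∞) Q {Y : EuclideanSpace ℝ (Fin 3) | 1 / 2 < Y 2 ∧ Y 2 < 4} ∧
      (∀ X ∈ {Y : EuclideanSpace ℝ (Fin 3) | 1 / 2 < Y 2 ∧ Y 2 < 4}, ‖V X‖ ≤ C ∧ |Q X| ≤ C) ∧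
      (∀ X ∈ {Y : EuclideanSpace ℝ (Fin 3) | 1 / 2 < Y 2 ∧ Y 2 < 4},
        ∑ i : Fin 3, (fderiv ℝ V X (EuclideanSpace.single i (1 : ℝ))) i = 0) ∧
      (∀ X ∈ {Y : EuclideanSpace ℝ (Fin 3) | 1 / 2 < Y 2 ∧ Y 2 < 4}, (fderiv ℝ V X) (V X) + gradient Q X = 0) ∧
      (∀ X : EuclideanSpace ℝ (Fin 3), 1 / 2 < X 2 → X 2 < 2 → V ((2 : ℝ) • X) = V X ∧ Q ((2 : ℝ) • X) = Q X) ∧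
      (∀ X : EuclideanSpace ℝ (Fin 3), 1 ≤ X 2 → X 2 ≤ 2 →
        V (X + EuclideanSpace.single 0 (1 : ℝ)) = V X ∧ V (X + EuclideanSpace.single 1 (1 : ℝ)) = V X ∧
        Q (X + EuclideanSpace.single 0 (1 : ℝ)) = Q X ∧ Q (X + EuclideanSpace.single 1 (1 : ℝ)) = Q X) ∧
      (∫ q in Set.Icc (0 : ℝ) 1 ×ˢ Set.Icc (0 : ℝ) 1, (V !₂[q.1, q.2, (1 : ℝ)]) 2 = 0) ∧ F ≠ 0 ∧
      (∫ q in Set.Icc (0 : ℝ) 1 ×ˢ Set.Icc (0 : ℝ) 1,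
        (V !₂[q.1, q.2, (1 : ℝ)]) 2 * (‖V !₂[q.1, q.2, (1 : ℝ)]‖ ^ 2 / 2 + Q !₂[q.1, q.2, (1 : ℝ)]) = F) :=
  -- LANDED p149183, cited by name.
  Summit.AnomalousDissipation.AnomalousDissipation.Theorems.HalfSpaceHierarchy.stub_slabOfBand

/-- **Tool stub (lead) `stub_bandEulerTools`.** Steady Euler, resp. zero divergence, on the open band plus the dilation
relation give the same on the whole open slab.  LANDED p148998: `Theorems/DyadicWallCascadeHalfSpaceHierarchyBandTools.lean`. -/
theorem stub_bandEulerTools :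
    (∀ (V : EuclideanSpace ℝ (Fin 3) → EuclideanSpace ℝ (Fin 3)) (Q : EuclideanSpace ℝ (Fin 3) → ℝ),
      ContDiffOn ℝ ((⊤ : ℕ∞) : WithTop ℕ∞) V {Y : EuclideanSpace ℝ (Fin 3) | 1 / 2 < Y 2 ∧ Y 2 < 4} →
      ContDiffOn ℝ ((⊤ : ℕ∞) : WithTop ℕ∞) Q {Y : EuclideanSpace ℝ (Fin 3) | 1 / 2 < Y 2 ∧ Y 2 < 4} →
      (∀ X : EuclideanSpace ℝ (Fin 3), 1 / 2 < X 2 → X 2 < 2 → V ((2 : ℝ) • X) = V X ∧ Q ((2 : ℝ) • X) = Q X) →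
      (∀ X : EuclideanSpace ℝ (Fin 3), 1 < X 2 → X 2 < 2 → (fderiv ℝ V X) (V X) + gradient Q X = 0) →
      ∀ X ∈ {Y : EuclideanSpace ℝ (Fin 3) | 1 / 2 < Y 2 ∧ Y 2 < 4}, (fderiv ℝ V X) (V X) + gradient Q X = 0) ∧
    (∀ (V : EuclideanSpace ℝ (Fin 3) → EuclideanSpace ℝ (Fin 3)),
      ContDiffOn ℝ ((⊤ : ℕ∞) : WithTop ℕ∞) V {Y : EuclideanSpace ℝ (Fin 3) | 1 / 2 < Y 2 ∧ Y 2 < 4} →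
      (∀ X : EuclideanSpace ℝ (Fin 3), 1 / 2 < X 2 → X 2 < 2 → V ((2 : ℝ) • X) = V X) →
      (∀ X : EuclideanSpace ℝ (Fin 3), 1 < X 2 → X 2 < 2 → ∑ i : Fin 3, (fderiv ℝ V X (EuclideanSpace.single i (1 : ℝ))) i = 0) →
      ∀ X ∈ {Y : EuclideanSpace ℝ (Fin 3) | 1 / 2 < Y 2 ∧ Y 2 < 4}, ∑ i : Fin 3, (fderiv ℝ V X (EuclideanSpace.single i (1 : ℝ))) i = 0) :=
  -- LANDED, cited by name.
  Summit.AnomalousDissipation.AnomalousDissipation.Theorems.HalfSpaceHierarchy.stub_bandEulerTools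

/-! ## §3 Tool stubs (the card's first lemmas, `SketchIdeator3.lean` unfolded)

LANDED in cycle 1 (wave 1), hence no longer stated here (their modules are imported once the farm has built them):
* `stub_curlOfDegreeZeroField` — `Theorems/DyadicWallCascadeHalfSpaceHierarchyCurlOfDegreeZeroField.lean` (p146512);
* `stub_fluxQuadruplesPerOctave` — `Theorems/DyadicWallCascadeHalfSpaceHierarchyFluxQuadruplesPerOctave.lean` (p146417);
* `stub_superCriticalMatchingInvertible` — `Theorems/DyadicWallCascadeHalfSpaceHierarchySuperCriticalMatching.lean` (p146503);
* `stub_subCriticalMatchingNotSurjective` — `Theorems/DyadicWallCascadeHalfSpaceHierarchySubCriticalMatching.lean` (p146520);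
* `stub_lambVectorIsBernoulliGradient` — `Theorems/DyadicWallCascadeHalfSpaceHierarchyLambVector.lean` (p146624).
All five tool stubs are landed. -/


/-! ## §3b Tool stubs, wave 2 (the remaining first lemmas of the ideators' sketches, restated without `let`)

From `SketchIdeator3.lean` (cards `octave-transfer-rpf`, `flat-bernoulli-leaves`): `stub_clebschCriticalPointIsSteadyEuler`
(the Buffoni–Wahlén / Grad–Rubin reconstruction), `stub_steadyEulerCommutesWithCurl` (Arnold's commuting frame, dossier (L1)).
From `SketchIdeator1.lean` (cards `slender-swirl-fission`, `bernoulli-surface-topology`): `stub_columnarSwirlSteadyEuler` (the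
exact "leg"), `stub_stagnationCurveOneLevel`, `stub_energyFluxPerOctave` (flux bookkeeping `∫_{[0,2]²} V₃B(·,2) = 4F`). -/

/-- **Tool stub.** Clebsch/Grad–Rubin reconstruction: if `V = ∇α × ∇β` on an open set `U` (`α, β ∈ C³(U)`, `G ∈ C²`)
and `ω = curl V` satisfies `⟪ω, ∇α⟫ = 0`, `⟪ω, ∇β⟫ = −G'(α)`, then `(V, G ∘ α − ‖V‖²/2)` is a steady Euler pair on `U`
(Bernoulli function `G ∘ α`).  Card `octave-transfer-rpf`, first lemma (`SketchIdeator3.ClebschCriticalPointIsSteadyEuler`,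
with the `let V` binder replaced by a defining hypothesis). -/
theorem stub_clebschCriticalPointIsSteadyEuler :  -- LANDED p148849
    ∀ (α β : EuclideanSpace ℝ (Fin 3) → ℝ) (G : ℝ → ℝ) (U : Set (EuclideanSpace ℝ (Fin 3)))
      (V : EuclideanSpace ℝ (Fin 3) → EuclideanSpace ℝ (Fin 3)), IsOpen U →
      ContDiffOn ℝ 3 α U → ContDiffOn ℝ 3 β U → ContDiff ℝ 2 G →
      (∀ X : EuclideanSpace ℝ (Fin 3), V X = Literature.Analysis.FluidPDE.cross (gradient α X) (gradient β X)) →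
      (∀ X ∈ U, inner ℝ (Literature.Analysis.FluidPDE.curl V X) (gradient α X) = 0) →
      (∀ X ∈ U, inner ℝ (Literature.Analysis.FluidPDE.curl V X) (gradient β X) = - deriv G (α X)) →
      ∀ X ∈ U, (fderiv ℝ V X) (V X) + gradient (fun Y => G (α Y) - ‖V Y‖ ^ 2 / 2) X = 0 :=
  -- LANDED, cited by name.
  Summit.AnomalousDissipation.AnomalousDissipation.Theorems.HalfSpaceHierarchy.stub_clebschCriticalPointIsSteadyEuler

/-- **Tool stub.** Arnold's commuting frame: for a `C²` steady Euler pair on an open set (divergence free,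
`(V·∇)V + ∇Q = 0`) the velocity and the vorticity commute, `(V·∇)ω − (ω·∇)V = 0` (the curl of the Euler equation;
`curl ∇Q = 0`, `div V = 0`).  Card `flat-bernoulli-leaves`, first lemma (`SketchIdeator3.SteadyEulerCommutesWithCurl`). -/
theorem stub_steadyEulerCommutesWithCurl :  -- LANDED p148983
    ∀ (V : EuclideanSpace ℝ (Fin 3) → EuclideanSpace ℝ (Fin 3)) (Q : EuclideanSpace ℝ (Fin 3) → ℝ)
      (U : Set (EuclideanSpace ℝ (Fin 3))), IsOpen U →
      ContDiffOn ℝ 2 V U → ContDiffOn ℝ 2 Q U →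
      (∀ X ∈ U, ∑ i : Fin 3, (fderiv ℝ V X (EuclideanSpace.single i (1 : ℝ))) i = 0) →
      (∀ X ∈ U, (fderiv ℝ V X) (V X) + gradient Q X = 0) →
      ∀ X ∈ U, fderiv ℝ (Literature.Analysis.FluidPDE.curl V) X (V X)
        - fderiv ℝ V X (Literature.Analysis.FluidPDE.curl V X) = 0 :=
  -- LANDED, cited by name.
  Summit.AnomalousDissipation.AnomalousDissipation.Theorems.HalfSpaceHierarchy.stub_steadyEulerCommutesWithCurl

/-- **Tool stub.** The exact "leg" of card `slender-swirl-fission`: a columnar swirling vortex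
`V = σ(ρ) (−y, x, 0) + w(ρ) e₂`, `Q = q(ρ)`, `ρ = x² + y²`, with smooth profiles `σ, w` and `q' = σ²/2`, is a smooth steady
Euler flow on all of `ℝ³` (divergence free, momentum balance).  `SketchIdeator1.ColumnarSwirlSteadyEuler` with the `let V/Q`
binders replaced by defining hypotheses. -/
theorem stub_columnarSwirlSteadyEuler :  -- LANDED p148672
    ∀ (σ w q : ℝ → ℝ) (V : EuclideanSpace ℝ (Fin 3) → EuclideanSpace ℝ (Fin 3)) (Q : EuclideanSpace ℝ (Fin 3) → ℝ),
      ContDiff ℝ ((⊤ : ℕ∞) : WithTop ℕ∞) σ → ContDiff ℝ ((⊤ : ℕ∞) : WithTop ℕ∞) w →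
      (∀ ρ : ℝ, HasDerivAt q (σ ρ ^ 2 / 2) ρ) →
      (∀ X : EuclideanSpace ℝ (Fin 3), V X = (σ (X 0 ^ 2 + X 1 ^ 2)) • (!₂[-(X 1), X 0, (0 : ℝ)] : EuclideanSpace ℝ (Fin 3))
          + (w (X 0 ^ 2 + X 1 ^ 2)) • EuclideanSpace.single (2 : Fin 3) (1 : ℝ)) →
      (∀ X : EuclideanSpace ℝ (Fin 3), Q X = q (X 0 ^ 2 + X 1 ^ 2)) →
      (∀ X : EuclideanSpace ℝ (Fin 3), ∑ i : Fin 3, (fderiv ℝ V X (EuclideanSpace.single i (1 : ℝ))) i = 0) ∧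
      (∀ X : EuclideanSpace ℝ (Fin 3), (fderiv ℝ V X) (V X) + gradient Q X = 0) :=
  -- LANDED, cited by name.
  Summit.AnomalousDissipation.AnomalousDissipation.Theorems.HalfSpaceHierarchy.stub_columnarSwirlSteadyEuler

/-- **Tool stub.** A differentiable curve of stagnation points of a steady Euler pair lies in ONE Bernoulli/pressure level:
`∇Q = −(V·∇)V = 0` at stagnation points, so `Q ∘ γ` has zero derivative.  `SketchIdeator1.StagnationCurveOneLevel`
(card `bernoulli-surface-topology`). -/
theorem stub_stagnationCurveOneLevel :  -- LANDED p148440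
    ∀ (V : EuclideanSpace ℝ (Fin 3) → EuclideanSpace ℝ (Fin 3)) (Q : EuclideanSpace ℝ (Fin 3) → ℝ)
      (U : Set (EuclideanSpace ℝ (Fin 3))), IsOpen U → ContDiffOn ℝ 1 Q U →
      (∀ X ∈ U, (fderiv ℝ V X) (V X) + gradient Q X = 0) →
      ∀ γ : ℝ → EuclideanSpace ℝ (Fin 3), Differentiable ℝ γ → (∀ t, γ t ∈ U) → (∀ t, V (γ t) = 0) →
        ∀ s t : ℝ, Q (γ s) = Q (γ t) :=
  -- LANDED, cited by name.
  Summit.AnomalousDissipation.AnomalousDissipation.Theorems.HalfSpaceHierarchy.stub_stagnationCurveOneLevel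

/-- **Tool stub.** Energy-flux bookkeeping per octave: for degree-`0` fields `V, Q` on the open half-space the energy
flux `∫ V₃ (‖V‖²/2 + Q)` through the dilated square `[0,2]²` at height `2` is `4×` the flux `F` through `[0,1]²` at height
`1` (pure change of variables; with steady Euler and band periodicity this is the statement "flux per unit area is the
same at every dyadic height").  `SketchIdeator1.FluxPerAreaDyadic`, minimal hypotheses. -/
theorem stub_energyFluxPerOctave :  -- LANDED p148498
    ∀ (V : EuclideanSpace ℝ (Fin 3) → EuclideanSpace ℝ (Fin 3)) (Q : EuclideanSpace ℝ (Fin 3) → ℝ) (F : ℝ),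
      (∀ X : EuclideanSpace ℝ (Fin 3), 0 < X 2 → V ((2 : ℝ) • X) = V X ∧ Q ((2 : ℝ) • X) = Q X) →
      (∫ q in Set.Icc (0 : ℝ) 1 ×ˢ Set.Icc (0 : ℝ) 1,
          (V !₂[q.1, q.2, (1 : ℝ)]) 2 * (‖V !₂[q.1, q.2, (1 : ℝ)]‖ ^ 2 / 2 + Q !₂[q.1, q.2, (1 : ℝ)]) = F) →
      (∫ q in Set.Icc (0 : ℝ) 2 ×ˢ Set.Icc (0 : ℝ) 2,
          (V !₂[q.1, q.2, (2 : ℝ)]) 2 * (‖V !₂[q.1, q.2, (2 : ℝ)]‖ ^ 2 / 2 + Q !₂[q.1, q.2, (2 : ℝ)])) = 4 * F :=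
  -- LANDED, cited by name.
  Summit.AnomalousDissipation.AnomalousDissipation.Theorems.HalfSpaceHierarchy.stub_energyFluxPerOctave

/-! ## §4 Composition (sorry-free) -/

/-- **Composition: the stubs prove the crux `HalfSpaceHierarchy` (by name).** The band profile
(`stub_bandProfile`), upgraded to a slab profile (`stub_slabOfBand`) and extended dyadically (`stub_slabExtension`),
is a half-space hierarchy. -/
theorem HalfSpaceHierarchy_of : HalfSpaceHierarchy :=
  stub_slabExtension (stub_slabOfBand stub_bandProfile)


/-- **The residual is the whole crux (converse of `stub_slabExtension`).** A half-space hierarchy restricts to a slab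
profile (the census's `halfSpace_to_slab`, restated for the inlined signature): so `stub_slabProfile ↔ HalfSpaceHierarchy`,
and promoting `stub_slabProfile` means re-lining the crux itself, on a domain that is compact modulo periods. -/
theorem slabProfile_of_halfSpaceHierarchy (h : HalfSpaceHierarchy) :
    ∃ (V : EuclideanSpace ℝ (Fin 3) → EuclideanSpace ℝ (Fin 3)) (Q : EuclideanSpace ℝ (Fin 3) → ℝ) (C F : ℝ),
      ContDiffOn ℝ ((⊤ : ℕ∞) : WithTop ℕ∞) V {Y : EuclideanSpace ℝ (Fin 3) | 1 / 2 < Y 2 ∧ Y 2 < 4} ∧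
      ContDiffOn ℝ ((⊤ : ℕ∞) : WithTop ℕ∞) Q {Y : EuclideanSpace ℝ (Fin 3) | 1 / 2 < Y 2 ∧ Y 2 < 4} ∧
      (∀ X ∈ {Y : EuclideanSpace ℝ (Fin 3) | 1 / 2 < Y 2 ∧ Y 2 < 4}, ‖V X‖ ≤ C ∧ |Q X| ≤ C) ∧
      (∀ X ∈ {Y : EuclideanSpace ℝ (Fin 3) | 1 / 2 < Y 2 ∧ Y 2 < 4},
        ∑ i : Fin 3, (fderiv ℝ V X (EuclideanSpace.single i (1 : ℝ))) i = 0) ∧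
      (∀ X ∈ {Y : EuclideanSpace ℝ (Fin 3) | 1 / 2 < Y 2 ∧ Y 2 < 4}, (fderiv ℝ V X) (V X) + gradient Q X = 0) ∧
      (∀ X : EuclideanSpace ℝ (Fin 3), 1 / 2 < X 2 → X 2 < 2 → V ((2 : ℝ) • X) = V X ∧ Q ((2 : ℝ) • X) = Q X) ∧
      (∀ X : EuclideanSpace ℝ (Fin 3), 1 ≤ X 2 → X 2 ≤ 2 →
        V (X + EuclideanSpace.single 0 (1 : ℝ)) = V X ∧ V (X + EuclideanSpace.single 1 (1 : ℝ)) = V X ∧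
        Q (X + EuclideanSpace.single 0 (1 : ℝ)) = Q X ∧ Q (X + EuclideanSpace.single 1 (1 : ℝ)) = Q X) ∧
      (∫ q in Set.Icc (0 : ℝ) 1 ×ˢ Set.Icc (0 : ℝ) 1, (V !₂[q.1, q.2, (1 : ℝ)]) 2 = 0) ∧ F ≠ 0 ∧
      (∫ q in Set.Icc (0 : ℝ) 1 ×ˢ Set.Icc (0 : ℝ) 1,
        (V !₂[q.1, q.2, (1 : ℝ)]) 2 * (‖V !₂[q.1, q.2, (1 : ℝ)]‖ ^ 2 / 2 + Q !₂[q.1, q.2, (1 : ℝ)]) = F) := by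
  obtain ⟨V, Q, C, F, hbody⟩ := h
  dsimp only at hbody
  obtain ⟨h1, h2, h3, h4, h5, h6, h7, h8, h9, h10⟩ := hbody
  have hsub : ({Y | 1 / 2 < Y 2 ∧ Y 2 < 4} : Set (EuclideanSpace ℝ (Fin 3))) ⊆ {X | 0 < X 2} := by
    intro X hX
    simp only [Set.mem_setOf_eq] at hX ⊢
    linarith [hX.1]
  refine ⟨V, Q, C, F, h1.mono hsub, h2.mono hsub, fun X hX => h3 X (hsub hX), fun X hX => h4 X (hsub hX),
    fun X hX => h5 X (hsub hX), fun X hX1 _hX2 => h6 X ?_, h7, h8, h9, h10⟩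
  simp only [Set.mem_setOf_eq]
  linarith


/-- **The v4 residual is still the whole crux.** A half-space hierarchy restricts to a band profile. -/
theorem bandProfile_of_halfSpaceHierarchy (h : HalfSpaceHierarchy) :
    ∃ (V : EuclideanSpace ℝ (Fin 3) → EuclideanSpace ℝ (Fin 3)) (Q : EuclideanSpace ℝ (Fin 3) → ℝ) (F : ℝ),
      ContDiffOn ℝ ((⊤ : ℕ∞) : WithTop ℕ∞) V {Y : EuclideanSpace ℝ (Fin 3) | 1 / 2 < Y 2 ∧ Y 2 < 4} ∧
      ContDiffOn ℝ ((⊤ : ℕ∞) : WithTop ℕ∞) Q {Y : EuclideanSpace ℝ (Fin 3) | 1 / 2 < Y 2 ∧ Y 2 < 4} ∧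
      (∀ X : EuclideanSpace ℝ (Fin 3), 1 < X 2 → X 2 < 2 →
        ∑ i : Fin 3, (fderiv ℝ V X (EuclideanSpace.single i (1 : ℝ))) i = 0) ∧
      (∀ X : EuclideanSpace ℝ (Fin 3), 1 < X 2 → X 2 < 2 → (fderiv ℝ V X) (V X) + gradient Q X = 0) ∧
      (∀ X : EuclideanSpace ℝ (Fin 3), 1 / 2 < X 2 → X 2 < 2 → V ((2 : ℝ) • X) = V X ∧ Q ((2 : ℝ) • X) = Q X) ∧
      (∀ X : EuclideanSpace ℝ (Fin 3), 1 ≤ X 2 → X 2 ≤ 2 →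
        V (X + EuclideanSpace.single 0 (1 : ℝ)) = V X ∧ V (X + EuclideanSpace.single 1 (1 : ℝ)) = V X ∧
        Q (X + EuclideanSpace.single 0 (1 : ℝ)) = Q X ∧ Q (X + EuclideanSpace.single 1 (1 : ℝ)) = Q X) ∧
      (∫ q in Set.Icc (0 : ℝ) 1 ×ˢ Set.Icc (0 : ℝ) 1, (V !₂[q.1, q.2, (1 : ℝ)]) 2 = 0) ∧ F ≠ 0 ∧
      (∫ q in Set.Icc (0 : ℝ) 1 ×ˢ Set.Icc (0 : ℝ) 1,
        (V !₂[q.1, q.2, (1 : ℝ)]) 2 * (‖V !₂[q.1, q.2, (1 : ℝ)]‖ ^ 2 / 2 + Q !₂[q.1, q.2, (1 : ℝ)]) = F) := by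
  obtain ⟨V, Q, C, F, hbody⟩ := h
  dsimp only at hbody
  obtain ⟨h1, h2, _h3, h4, h5, h6, h7, h8, h9, h10⟩ := hbody
  have hsub : ({Y | 1 / 2 < Y 2 ∧ Y 2 < 4} : Set (EuclideanSpace ℝ (Fin 3))) ⊆ {X | 0 < X 2} := by
    intro X hX
    simp only [Set.mem_setOf_eq] at hX ⊢
    linarith [hX.1]
  refine ⟨V, Q, F, h1.mono hsub, h2.mono hsub, fun X hX1 _ => h4 X ?_, fun X hX1 _ => h5 X ?_,
    fun X hX1 _hX2 => h6 X ?_, h7, h8, h9, h10⟩ <;>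
  · simp only [Set.mem_setOf_eq]
    linarith


/-! ## §5 Negative-side tool stubs (continuation lead c1, 2026-08-17): the 2½-D no-go

While the residual `stub_bandProfile` (≡ crux) is worked on paper, the line lands the one theorem about it that is
within reach and missing from the tree: **no witness of the crux is independent of a horizontal coordinate**
(`not_xIndependentHalfSpaceHierarchy`, the disprover's sorried near-miss `Disproof.lean` §C; planners' "2-D is
empty").  NEW ELEMENTARY PROOF (no flow maps, no coarea): for an `x`-independent witness the planar field `(v, w)(y, z)`
has a smooth stream function `ψ` on the open half-plane (closed `1`-form `v dz − w dy`, Poincaré lemma on the convex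
`H`); the head `B = ‖V‖²/2 + Q` is a first integral (`v B_y + w B_z = 0`), so for EVERY `C¹` function `f` the planar
field `f(ψ) B (v, w)` is divergence free and Green's formula on `[0,1] × [h,1]` plus `y`-periodicity give
`∫₀¹ f(ψ) B w dy |_{z=1} = ∫₀¹ f(ψ) B w dy |_{z=h}`; normalising `ψ (2X) = 2 ψ X` (dilation law) makes
`|ψ| ≤ M 2^{-k}` at height `2^{-k}`, so with `f = cos(·/ε)` the right side tends to `∫₀¹ B w dy = F` as
`h = 2^{-k} → 0`; at `z = 1` one integration by parts (`cos(ψ/ε) ψ_y = ε ∂_y sin(ψ/ε)`, periodic ends) bounds the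
left side by `ε ∫₀¹ |B_y|`; hence `|F| ≤ ε K` for every `ε > 0`, i.e. `F = 0`.  The steps are registered as tool
stubs (`stub_xIndepStreamFunction`, `stub_headFluxTransport`, `stub_oscillatoryIBP`, `stub_sliceIntegral`) and the
theorem itself as `stub_notXIndependent`; they do not enter `HalfSpaceHierarchy_of`. -/

/-- **Tool stub (c1).** Stream function of an `x`-independent divergence-free smooth field on the open half-space:
there is `ψ`, smooth on `H`, with `dψ = V₁ dz − V₂ dy` (so `∂_y ψ = −V₂`, `∂_z ψ = V₁`, `∂_x ψ = 0`).  Poincaré lemma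
for the closed `1`-form `X ↦ V₁(X) dz − V₂(X) dy` on the convex open set `H`
(`Literature.Analysis.Calculus.exists_contDiffOn_hasFDerivAt_of_fderiv_symm_of_starConvex`); closedness is
`∂_y V₁ + ∂_z V₂ = 0`, i.e. the divergence clause minus `∂_x V₀ = 0`. -/
theorem stub_xIndepStreamFunction :
    ∀ (V : EuclideanSpace ℝ (Fin 3) → EuclideanSpace ℝ (Fin 3)),
      ContDiffOn ℝ ((⊤ : ℕ∞) : WithTop ℕ∞) V {X : EuclideanSpace ℝ (Fin 3) | 0 < X 2} →
      (∀ X : EuclideanSpace ℝ (Fin 3), 0 < X 2 → ∀ t : ℝ, V (X + t • EuclideanSpace.single 0 (1 : ℝ)) = V X) →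
      (∀ X : EuclideanSpace ℝ (Fin 3), 0 < X 2 →
        ∑ i : Fin 3, (fderiv ℝ V X (EuclideanSpace.single i (1 : ℝ))) i = 0) →
      ∃ ψ : EuclideanSpace ℝ (Fin 3) → ℝ,
        ContDiffOn ℝ ((⊤ : ℕ∞) : WithTop ℕ∞) ψ {X : EuclideanSpace ℝ (Fin 3) | 0 < X 2} ∧
        ∀ X : EuclideanSpace ℝ (Fin 3), 0 < X 2 →
          HasFDerivAt ψ ((V X 1) • (EuclideanSpace.proj (2 : Fin 3) : EuclideanSpace ℝ (Fin 3) →L[ℝ] ℝ)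
            - (V X 2) • (EuclideanSpace.proj (1 : Fin 3) : EuclideanSpace ℝ (Fin 3) →L[ℝ] ℝ)) X :=
  -- LANDED p153514, cited by name.
  Summit.AnomalousDissipation.AnomalousDissipation.Theorems.HalfSpaceHierarchy.stub_xIndepStreamFunction

/-- **Tool stub (c1).** Transport of the head flux between heights (Green's formula).  On the open half-plane
`{(y, z) : z > 0}` let `ψ, b, v, w` be `C¹` with `∂_y ψ = −w`, `∂_z ψ = v`, `∂_y v + ∂_z w = 0`,
`v ∂_y b + w ∂_z b = 0`, all `1`-periodic in `y` for `0 < z ≤ 1`; then for every `C¹` function `f` and `0 < h ≤ 1`,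
`∫₀¹ f(ψ) b w (y, 1) dy = ∫₀¹ f(ψ) b w (y, h) dy` — the planar field `f(ψ) b (v, w)` is divergence free, and
Green's formula on `[0,1] × [h,1]` (`MeasureTheory.integral2_divergence_prod_of_hasFDerivWithinAt_off_countable`)
has cancelling lateral terms. -/
theorem stub_headFluxTransport :
    ∀ (ψ b v w : ℝ × ℝ → ℝ) (f : ℝ → ℝ) (h : ℝ), 0 < h → h ≤ 1 → ContDiff ℝ 1 f →
      ContDiffOn ℝ 1 ψ {p : ℝ × ℝ | 0 < p.2} → ContDiffOn ℝ 1 b {p : ℝ × ℝ | 0 < p.2} →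
      ContDiffOn ℝ 1 v {p : ℝ × ℝ | 0 < p.2} → ContDiffOn ℝ 1 w {p : ℝ × ℝ | 0 < p.2} →
      (∀ p : ℝ × ℝ, 0 < p.2 → fderiv ℝ ψ p (1, 0) = - w p ∧ fderiv ℝ ψ p (0, 1) = v p) →
      (∀ p : ℝ × ℝ, 0 < p.2 → fderiv ℝ v p (1, 0) + fderiv ℝ w p (0, 1) = 0) →
      (∀ p : ℝ × ℝ, 0 < p.2 → v p * fderiv ℝ b p (1, 0) + w p * fderiv ℝ b p (0, 1) = 0) →
      (∀ z : ℝ, 0 < z → z ≤ 1 → ψ (1, z) = ψ (0, z) ∧ b (1, z) = b (0, z) ∧ v (1, z) = v (0, z)) →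
      ∫ y in (0 : ℝ)..1, f (ψ (y, 1)) * b (y, 1) * w (y, 1) =
        ∫ y in (0 : ℝ)..1, f (ψ (y, h)) * b (y, h) * w (y, h) :=
  -- LANDED p153143, cited by name.
  Summit.AnomalousDissipation.AnomalousDissipation.Theorems.HalfSpaceHierarchy.stub_headFluxTransport

/-- **Tool stub (c1).** The oscillatory integration by parts that ends the argument: for `C¹` functions `ψ, b` on
`ℝ` with `ψ 1 = ψ 0`, `b 1 = b 0` and `ε > 0`,
`|∫₀¹ cos(ψ/ε) b ψ' dy| ≤ ε ∫₀¹ |b'| dy` (`cos(ψ/ε) ψ' = ε (sin(ψ/ε))'`, the boundary term is periodic). -/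
theorem stub_oscillatoryIBP :
    ∀ (ψ b : ℝ → ℝ) (ε : ℝ), 0 < ε → ContDiff ℝ 1 ψ → ContDiff ℝ 1 b → ψ 1 = ψ 0 → b 1 = b 0 →
      |∫ y in (0 : ℝ)..1, Real.cos (ψ y / ε) * b y * deriv ψ y| ≤ ε * ∫ y in (0 : ℝ)..1, |deriv b y| :=
  -- LANDED p152974, cited by name.
  Summit.AnomalousDissipation.AnomalousDissipation.Theorems.HalfSpaceHierarchy.stub_oscillatoryIBP

/-- **Tool stub (c1).** Flux integrals of an `x`-independent integrand are slice integrals: for a continuous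
`g : ℝ × ℝ → ℝ` with `g q = g (0, q.2)`, `∫_{[0,1]²} g = ∫₀¹ g (0, y) dy` (Fubini on the product square). -/
theorem stub_sliceIntegral :
    ∀ (g : ℝ × ℝ → ℝ), Continuous g → (∀ q : ℝ × ℝ, g q = g (0, q.2)) →
      ∫ q in Set.Icc (0 : ℝ) 1 ×ˢ Set.Icc (0 : ℝ) 1, g q = ∫ y in (0 : ℝ)..1, g (0, y) :=
  -- LANDED p153002, cited by name.
  Summit.AnomalousDissipation.AnomalousDissipation.Theorems.HalfSpaceHierarchy.stub_sliceIntegral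


/-- **Tools stub (c1) `stub_xIndepSliceTools`.** Conjunction of the headline slice tools used by the
assembly of `stub_notXIndependent`: dyadic descent of horizontal periods to every height `0 < z ≤ 2`
(vector- and scalar-valued), the normalised stream function (`ψ (2X) = 2 ψ X`, from
`stub_xIndepStreamFunction` plus constancy of `ψ(2X) − 2ψ(X)` on the connected half-space), and
boundedness of continuous `1`-periodic functions. -/
theorem stub_xIndepSliceTools :
    (∀ (f : EuclideanSpace ℝ (Fin 3) → EuclideanSpace ℝ (Fin 3)) (v : EuclideanSpace ℝ (Fin 3)), v 2 = 0 →
      (∀ X : EuclideanSpace ℝ (Fin 3), 0 < X 2 → f ((2 : ℝ) • X) = f X) →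
      (∀ X : EuclideanSpace ℝ (Fin 3), 1 ≤ X 2 → X 2 ≤ 2 → f (X + v) = f X) →
      ∀ X : EuclideanSpace ℝ (Fin 3), 0 < X 2 → X 2 ≤ 2 → f (X + v) = f X) ∧
    (∀ (f : EuclideanSpace ℝ (Fin 3) → ℝ) (v : EuclideanSpace ℝ (Fin 3)), v 2 = 0 →
      (∀ X : EuclideanSpace ℝ (Fin 3), 0 < X 2 → f ((2 : ℝ) • X) = f X) →
      (∀ X : EuclideanSpace ℝ (Fin 3), 1 ≤ X 2 → X 2 ≤ 2 → f (X + v) = f X) →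
      ∀ X : EuclideanSpace ℝ (Fin 3), 0 < X 2 → X 2 ≤ 2 → f (X + v) = f X) ∧
    (∀ (V : EuclideanSpace ℝ (Fin 3) → EuclideanSpace ℝ (Fin 3)),
      ContDiffOn ℝ ((⊤ : ℕ∞) : WithTop ℕ∞) V {X : EuclideanSpace ℝ (Fin 3) | 0 < X 2} →
      (∀ X : EuclideanSpace ℝ (Fin 3), 0 < X 2 → ∀ t : ℝ, V (X + t • EuclideanSpace.single 0 (1 : ℝ)) = V X) →
      (∀ X : EuclideanSpace ℝ (Fin 3), 0 < X 2 →
        ∑ i : Fin 3, (fderiv ℝ V X (EuclideanSpace.single i (1 : ℝ))) i = 0) →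
      (∀ X : EuclideanSpace ℝ (Fin 3), 0 < X 2 → V ((2 : ℝ) • X) = V X) →
      ∃ ψ : EuclideanSpace ℝ (Fin 3) → ℝ,
        ContDiffOn ℝ ((⊤ : ℕ∞) : WithTop ℕ∞) ψ {X : EuclideanSpace ℝ (Fin 3) | 0 < X 2} ∧
        (∀ X : EuclideanSpace ℝ (Fin 3), 0 < X 2 →
          HasFDerivAt ψ ((V X 1) • (EuclideanSpace.proj (2 : Fin 3) : EuclideanSpace ℝ (Fin 3) →L[ℝ] ℝ)
            - (V X 2) • (EuclideanSpace.proj (1 : Fin 3) : EuclideanSpace ℝ (Fin 3) →L[ℝ] ℝ)) X) ∧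
        (∀ X : EuclideanSpace ℝ (Fin 3), 0 < X 2 → ψ ((2 : ℝ) • X) = 2 * ψ X)) ∧
    (∀ g : ℝ → ℝ, Continuous g → (∀ s : ℝ, g (s + 1) = g s) → ∃ M : ℝ, ∀ s : ℝ, |g s| ≤ M) :=
  -- LANDED p154165, cited by name.
  Summit.AnomalousDissipation.AnomalousDissipation.Theorems.HalfSpaceHierarchy.stub_xIndepSliceTools

/-- **Stub (c1, negative side): no `x`-independent witness.** The crux body (verbatim) together with
"`V` and `Q` do not depend on `x`" (`V (X + t e₀) = V X`, `Q (X + t e₀) = Q X` on `H`) is FALSE — the 2½-D no-go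
(planners' L2 "2-D is empty", disprover's near-miss), by the argument in the §5 header.  Lands as
`Theorems.not_xIndependentHalfSpaceHierarchy` (Negative lane) with this alias. -/
theorem stub_notXIndependent :
    ¬ (∃ (V : EuclideanSpace ℝ (Fin 3) → EuclideanSpace ℝ (Fin 3)) (Q : EuclideanSpace ℝ (Fin 3) → ℝ) (C F : ℝ),
        (ContDiffOn ℝ ((⊤ : ℕ∞) : WithTop ℕ∞) V {X : EuclideanSpace ℝ (Fin 3) | 0 < X 2} ∧
         ContDiffOn ℝ ((⊤ : ℕ∞) : WithTop ℕ∞) Q {X : EuclideanSpace ℝ (Fin 3) | 0 < X 2} ∧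
         (∀ X ∈ {X : EuclideanSpace ℝ (Fin 3) | 0 < X 2}, ‖V X‖ ≤ C ∧ |Q X| ≤ C) ∧
         (∀ X ∈ {X : EuclideanSpace ℝ (Fin 3) | 0 < X 2},
            ∑ i : Fin 3, (fderiv ℝ V X (EuclideanSpace.single i (1 : ℝ))) i = 0) ∧
         (∀ X ∈ {X : EuclideanSpace ℝ (Fin 3) | 0 < X 2}, (fderiv ℝ V X) (V X) + gradient Q X = 0) ∧
         (∀ X ∈ {X : EuclideanSpace ℝ (Fin 3) | 0 < X 2}, V ((2 : ℝ) • X) = V X ∧ Q ((2 : ℝ) • X) = Q X) ∧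
         (∀ X : EuclideanSpace ℝ (Fin 3), 1 ≤ X 2 → X 2 ≤ 2 →
            V (X + EuclideanSpace.single 0 (1 : ℝ)) = V X ∧ V (X + EuclideanSpace.single 1 (1 : ℝ)) = V X ∧
            Q (X + EuclideanSpace.single 0 (1 : ℝ)) = Q X ∧ Q (X + EuclideanSpace.single 1 (1 : ℝ)) = Q X) ∧
         (∫ q in Set.Icc (0 : ℝ) 1 ×ˢ Set.Icc (0 : ℝ) 1, (V !₂[q.1, q.2, (1 : ℝ)]) 2 = 0) ∧ F ≠ 0 ∧
         (∫ q in Set.Icc (0 : ℝ) 1 ×ˢ Set.Icc (0 : ℝ) 1,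
            (V !₂[q.1, q.2, (1 : ℝ)]) 2 * (‖V !₂[q.1, q.2, (1 : ℝ)]‖ ^ 2 / 2 + Q !₂[q.1, q.2, (1 : ℝ)]) = F)) ∧
        (∀ (X : EuclideanSpace ℝ (Fin 3)) (t : ℝ), 0 < X 2 →
            V (X + t • EuclideanSpace.single 0 (1 : ℝ)) = V X ∧ Q (X + t • EuclideanSpace.single 0 (1 : ℝ)) = Q X)) := by
  -- LANDED p154801 (`Theorems/HalfSpaceHierarchy/Negative/XIndependent.lean`,
  -- `…Theorems.HalfSpaceHierarchy.stub_notXIndependent` / `…Theorems.not_xIndependentHalfSpaceHierarchy`); cited here by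
  -- `sorry` only because the module had no olean on the check farm when this workfile was published — import it directly.
  sorry

end Summit.AnomalousDissipation.AnomalousDissipation.Cruxes.HalfSpaceHierarchy.SketchLine

end
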